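import Summits.ValiantsHypothesis.ValiantsHypothesis.Theorems.BarrierLeverChowThinRowsStarColumns
import Literature.Barriers.ValiantsHypothesis.BDGIL24AffineInputsVP

/-!
# Route BarrierLever — items `ChowHitsThinRowPartitionMinors` (stmt-ValiantsHypothesis-20195) and
# `PartitionMinorsHitByVP` (stmt-ValiantsHypothesis-19717): their STAR-COLUMN slices of the pair layer

Helper file (`--supports stmt-ValiantsHypothesis-20195`; cell valiant-natproofs, rung V4, 𝒟-side of
door (c); prover seat val-np-p8 gen 2).  Closes NO item; imports `…ChowThinRowsStarColumns` (val-np-p8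
g2, `chowHits_thinRows_starColumns`) and the route-independent Literature module
`Literature.Barriers.ValiantsHypothesis.BDGIL24AffineInputsVP` (`SmallCircuits`,
`BergEtAl2024.complexity_le_of_totalDegree_le_one`, `complexity_finset_prod_le`); no definitions, no
route file in the import cone.  Pattern of val-np-p7 g4's `…ChowThinRowsFirstOrderSlice`.

* `chowHitsThinRowPartitionMinors_starColumns` — item 20195's statement VERBATIM with two extra
  hypotheses: some row is empty and every column has size `≤ 1` (threshold `h₀ = 1`).
* `partitionMinorsHitByVP_thinRows_starColumns` — item 19717's statement VERBATIM restricted to the same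
  layouts (rows of size `≤ 2` one of which is empty, columns of size `≤ 1`; `b = 3`, `h₀ = 2`): every
  such partition minor is hit by a small circuit (the product of affine forms itself), unconditionally.

WHAT THIS IS NOT: rows without the empty row / columns of size `≥ 2` are not covered; items 20195 /
20172 / 19717 are NOT proved; nothing on crux stmt-ValiantsHypothesis-14610 or `VP` versus `VNP`.
-/

set_option linter.dupNamespace false

namespace Summit.ValiantsHypothesis.ValiantsHypothesis.Theorems.BarrierLever.ChowSubcube

open MvPolynomial Literature.Barriers.ValiantsHypothesis Literature.Computability.AlgebraicComplexity

/-- **Star-column slice of item 20195**: item `ChowHitsThinRowPartitionMinors` verbatim, with the two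
extra hypotheses «some row is `∅`» and «every column has size `≤ 1`» — holds with `h₀ = 1`. -/
theorem chowHitsThinRowPartitionMinors_starColumns :
    ∃ h₀ : ℕ, ∀ h : ℕ, h₀ ≤ h → ∀ (r : ℕ) (u w : Fin r → Finset (Fin h)),
      Function.Injective u → Function.Injective w → (∀ i, (u i).card ≤ 2) →
        (∃ i₀, u i₀ = ∅) → (∀ j, (w j).card ≤ 1) →
        ∃ ℓ : Fin (h + h) → MvPolynomial (Fin (h + h)) ℂ, (∀ k, (ℓ k).totalDegree ≤ 1) ∧
          (Matrix.of fun i j : Fin r => MvPolynomial.coeff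
            (∑ a ∈ u i, Finsupp.single (Fin.castAdd h a) 1 +
              ∑ c ∈ w j, Finsupp.single (Fin.natAdd h c) 1) (∏ k, ℓ k)).det ≠ 0 :=
  ⟨1, fun h hh r u w hu hw hu2 h0 hw1 => chowHits_thinRows_starColumns h hh r u w hu hw hu2 h0 hw1⟩

/-- **Star-column slice of item 19717, unconditionally**: item `PartitionMinorsHitByVP` verbatim
restricted to layouts whose rows have size `≤ 2` with one empty row and whose columns have size `≤ 1` —
with `b = 3`, `h₀ = 2`, every such partition minor is hit by some `f ∈ SmallCircuits ℂ (h+h) 3` (the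
product of affine forms of `chowHits_thinRows_starColumns`: degree `≤ h+h`, size `≤ (h+h)³`).
[cite: ForbesShpilkaVolk2018, §8] -/
theorem partitionMinorsHitByVP_thinRows_starColumns :
    ∃ b h₀ : ℕ, ∀ h : ℕ, h₀ ≤ h → ∀ (r : ℕ) (u w : Fin r → Finset (Fin h)),
      Function.Injective u → Function.Injective w → (∀ i, (u i).card ≤ 2) →
        (∃ i₀, u i₀ = ∅) → (∀ j, (w j).card ≤ 1) →
        ∃ f ∈ SmallCircuits ℂ (h + h) b,
          (Matrix.of fun i j : Fin r => MvPolynomial.coeff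
            (∑ a ∈ u i, Finsupp.single (Fin.castAdd h a) 1 +
              ∑ c ∈ w j, Finsupp.single (Fin.natAdd h c) 1) f).det ≠ 0 := by
  refine ⟨3, 2, fun h hh r u w hu hw hu2 h0 hw1 => ?_⟩
  obtain ⟨ℓ, hℓ, hdet⟩ := chowHits_thinRows_starColumns h (by omega) r u w hu hw hu2 h0 hw1
  have h3 : 3 ≤ h + h := by omega
  refine ⟨∏ k, ℓ k, ⟨?_, ?_⟩, hdet⟩
  · calc (∏ k, ℓ k).totalDegree ≤ ∑ k, (ℓ k).totalDegree := totalDegree_finsetProd _ _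
      _ ≤ ∑ _k : Fin (h + h), 1 := Finset.sum_le_sum fun k _ => hℓ k
      _ = h + h := by simp
  · have hterm : ∀ k, complexity (ℓ k) ≤ 2 * (h + h) + 1 := fun k => by
      simpa [Fintype.card_fin] using BergEtAl2024.complexity_le_of_totalDegree_le_one (hℓ k)
    calc complexity (∏ k, ℓ k)
        ≤ ∑ k, complexity (ℓ k) + (Finset.univ : Finset (Fin (h + h))).card :=
          complexity_finset_prod_le _ _
      _ ≤ ∑ _k : Fin (h + h), (2 * (h + h) + 1) + (h + h) := by
          rw [Finset.card_univ, Fintype.card_fin]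
          exact Nat.add_le_add_right (Finset.sum_le_sum fun k _ => hterm k) _
      _ = (h + h) * (2 * (h + h) + 1) + (h + h) := by simp
      _ ≤ (h + h) ^ 3 := by
          have h2 : 3 * ((h + h) * (h + h)) ≤ (h + h) * ((h + h) * (h + h)) :=
            Nat.mul_le_mul_right ((h + h) * (h + h)) h3
          calc (h + h) * (2 * (h + h) + 1) + (h + h) = 2 * ((h + h) * (h + h)) + 2 * (h + h) := by ring
            _ ≤ 3 * ((h + h) * (h + h)) := by nlinarith
            _ ≤ (h + h) * ((h + h) * (h + h)) := h2
            _ = (h + h) ^ 3 := by ring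

end Summit.ValiantsHypothesis.ValiantsHypothesis.Theorems.BarrierLever.ChowSubcube
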